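import Summits.Ventures.CertifiedManyBodySolver.Theses.M3PrimeEdgeSplit
import Summits.Ventures.CertifiedManyBodySolver.Theorems.M3x2EdgeSplitSymReplaySound
import Summits.Ventures.CertifiedManyBodySolver.Theorems.M3x2EdgeSplitSymReplayGramRSoundB
import Summits.Ventures.CertifiedManyBodySolver.Theorems.M3x2EdgeSplitSymReplayNormalWordsIndependent
import Summits.Ventures.CertifiedManyBodySolver.Theorems.M3x2EdgeSplitLowerRowW3Box
import HarnessLib

/-!
# Line «symreplay» for `LowerEdge_ge_m4o5` — rev 11: the skeleton REBASED on the landed checker (ONE open stub: the data)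
(pen hub-lb-sym-plan-1 g2, 2026-08-28; UNREGISTERED crux workfile — the skeleton of record for this item stays
`Lines/fo_dual_rounding.lean` (hub-lb-dual-plan-2, rev 4); no registry write is made or implied by this file.)

HISTORY.  Revs 1–10 (hub-lb-sym-plan-1 g0/g1, 187 KB) carried the whole word-form checker — Parts A–G: syntax, CAR normal-orderer,
anchored affine-`D₄` canonicaliser, semantics, dictionary, soundness — with stubs S1–S8.  Since then team lb-sym LANDED all of it in the tree
(`Theorems/M3x2EdgeSplitSymReplay{Syntax, NormalOrder, Moves, Dictionary, Semantics, SoundA–D, Sound, SyntaxV, ShardsA–D, Decode, GramRSyntax,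
GramRSoundA/B, GramRShards, GramRDecode, LocalA/B, Fill, NormalWords, NormalWordsIndependent}.lean`, landed by hub-lb-sym-eng-3 / -eng-4;
the pen's later additive texts `GramRShardsFast_symplan1.lean` (grouped R-shards) and `SU2Lower_symplan1.lean` (su2R) are crux workfiles awaiting
landing).  In the tree, with NO hypothesis and standard axioms: S1 `SymReplay.stub_nfFaithful`, S2 `SymReplay.stub_moveSound`,
S3 `SymReplay.stub_dictionarySound`, S4 `SymReplay.stub_soundOfKernels`, S6 `WardSlot.stub_wardWindowSound`, S7 `SymReplay.stub_normalWordsIndependent`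
(all PROVED, the `stub_` prefix is historical), assembled as `SymReplay.energyDensity_ge_symValue : symCheck K = true → symValue K ≤ e₀(1,0,8,7/8)`.
rev 11 therefore DROPS the duplicated Parts A–G (rev 10 is in git history) and imports the tree: what is left of the line is exactly

* **S5 (XL; DATA; the ONLY `sorry`)** `stub_symCertData : ∃ K : SymCert, symCheck K = true ∧ -4 / 5 ≤ symValue K` — a word-form certificate
  literal of value `≥ −4/5` accepted by the kernel / `native_decide`.  By VALUE it exists outside Lean (CERTIFIED #529, E₁ = −0.8295699476,
  still 0.0296 BELOW −4/5: by value this twin is OPEN); its bytes are the obstacle (crit-1 SIZE LINE v4: ≈ 25–32 MB under fill + v2 + gramR + su2R, ≈ 150–190 data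
  proposals; today's rehearsal object v0′ ≈ −1.00 does not reach −4/5).
* three PROVED entry doors for S5's content, in the currencies the landings accept: (i) one call `symCheck K` (T10); (ii) R-form
  `symCheckR K` (gramR, `SymReplay.energyDensity_ge_symValueR`; su2R certificates enter as `K.lower`); (iii) ANY certified Ward × `D₄` window
  value `WardD4CertGe q` with `-4 / 5 ≤ q` — the conclusion of every SHARDED / GROUPED closing (`SymReplay.wardD4CertGe_of_shardsRLV / …RGV` of
  `GramRShardsFast`), so a multi-module landing needs no further glue here.
* the floor in this currency, unconditional in the tree: the W3BOX rung `Theorems.m3_tp0_lowerRow_w3box` (`lo ≈ −1.0238`; 0.224 below −4/5).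

S8 `MoveEquivariant` (optional support, never consumed by the composition) is not restated; its rev-10 text stays in git history.
HONEST FRAMING: no certificate of value `≥ −4/5` exists in Lean; no bound of record moves; no summit or crux statement is proved here
(the skeleton theorem below depends on the `sorry` of S5 and says so); nothing here predicts superconductivity.
-/

noncomputable section

namespace Summit.Ventures.CertifiedManyBodySolver.Cruxes.LowerEdge_ge_m4o5.SymReplay

open Literature.MathematicalPhysics.QuantumLattice
open Literature.MathematicalPhysics.QuantumLattice.HubbardWave0
open Literature.MathematicalPhysics.QuantumLattice.ThermodynamicLimit
open Literature.Probability.LatticeModels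
open Summit.Ventures.CertifiedManyBodySolver.Theorems
open Summit.Ventures.CertifiedManyBodySolver.Theorems.SymReplay
open Summit.Ventures.CertifiedManyBodySolver.Theorems.WardSlot

/-! ### The one open stub -/

/-- **S5 (XL — the computational crux in word form; DATA).**  A syntactic certificate passing the landed checker `symCheck` with value
`≥ −4/5` exists. -/
def SymCertData : Prop :=
  ∃ K : SymCert, symCheck K = true ∧ (-4 / 5 : ℚ) ≤ symValue K

theorem stub_symCertData : SymCertData := by
  sorry

/-! ### The three proved doors (no `sorry` below this line except through `stub_symCertData` where named) -/

/-- S5 in the most general currency: a certified Ward × affine-`D₄` window value `≥ −4/5` — what every sharded / grouped / R-form /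
su2R closing of the landed checker delivers. -/
def WardD4Value : Prop :=
  ∃ q : ℚ, (-4 / 5 : ℚ) ≤ q ∧ WardD4CertGe ((q : ℚ) : ℝ)

/-- Door (i) feeds door (iii): a passing `SymCert` is a certified window value (T10's soundness, tree, unconditional). -/
theorem wardD4Value_of_symCertData : SymCertData → WardD4Value :=
  fun ⟨K, hK, hv⟩ => ⟨symValue K, hv, stub_soundOfKernels stub_nfFaithful stub_moveSound stub_dictionarySound K hK⟩

/-- Door (ii) feeds door (iii): a passing R-form certificate (gramR; su2R via `SymCertS.lower`) is a certified window value. -/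
theorem wardD4Value_of_symCertR (K : SymCertR) (hK : symCheckR K = true) (hv : (-4 / 5 : ℚ) ≤ symValueR K) : WardD4Value :=
  ⟨symValueR K, hv, symCheckR_sound K hK⟩

/-- **Door (iii) ⇒ the crux BY NAME**: any certified Ward × `D₄` window value `≥ −4/5` decides `LowerEdge_ge_m4o5` (S6 + the
thermodynamic-limit soundness, tree, unconditional). -/
theorem LowerEdge_ge_m4o5_of_wardD4Value :
    WardD4Value → Summit.Ventures.CertifiedManyBodySolver.Theses.M3PrimeEdgeSplit.LowerEdge_ge_m4o5 := by
  rintro ⟨q, hq, h⟩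
  show ∃ lo : ℚ, (-4 / 5 : ℚ) ≤ lo ∧ Summit.Ventures.CertifiedManyBodySolver.M3EnergyLowerRow 0 lo
  exact ⟨q, hq, energyDensity_ge_of_windowSound_cert _ stub_wardWindowSound h⟩

/-- **The composition** (kernel-checked, no `sorry` of its own): S5 ⇒ the crux BY NAME. -/
theorem LowerEdge_ge_m4o5_of :
    SymCertData → Summit.Ventures.CertifiedManyBodySolver.Theses.M3PrimeEdgeSplit.LowerEdge_ge_m4o5 :=
  fun h => LowerEdge_ge_m4o5_of_wardD4Value (wardD4Value_of_symCertData h)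

/-- The same through T10's assembled closing (one call). -/
theorem LowerEdge_ge_m4o5_of' :
    SymCertData → Summit.Ventures.CertifiedManyBodySolver.Theses.M3PrimeEdgeSplit.LowerEdge_ge_m4o5 := by
  rintro ⟨K, hK, hv⟩
  show ∃ lo : ℚ, (-4 / 5 : ℚ) ≤ lo ∧ Summit.Ventures.CertifiedManyBodySolver.M3EnergyLowerRow 0 lo
  exact ⟨symValue K, hv, energyDensity_ge_symValue K hK⟩

/-- The skeleton: the crux from its one stub (depends on the `sorry` of `stub_symCertData`; proves nothing today). -/
theorem lowerEdge_ge_m4o5_skeleton : Summit.Ventures.CertifiedManyBodySolver.Theses.M3PrimeEdgeSplit.LowerEdge_ge_m4o5 :=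
  LowerEdge_ge_m4o5_of stub_symCertData

/-! ### Where the line stands in this currency (tree facts, unconditional) -/

/-- The floor: the W3BOX rung, `∃ lo ≥ −1.0239` with the row — 0.224 below −4/5. -/
example : ∃ lo : ℚ, (-1.0239 : ℚ) ≤ lo ∧ Summit.Ventures.CertifiedManyBodySolver.M3EnergyLowerRow 0 lo :=
  exists_m3_tp0_lowerRow_ge_m1p0239

/-- The smallest end-to-end instance of door (ii): the R-form toy (`−11/4`, kernel) is a certified window value — of course far below
`−4/5`, so it opens no door; recorded to show the doors are live terms, not promises. -/
example : WardD4CertGe ((symValueR toyRCert : ℚ) : ℝ) := symCheckR_sound toyRCert (by decide +kernel)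

end Summit.Ventures.CertifiedManyBodySolver.Cruxes.LowerEdge_ge_m4o5.SymReplay
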